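import Summits.BirchSwinnertonDyer.BirchSwinnertonDyer.Theorems.ByReductionTypeAtTwoAnalyticMuZero
import Summits.BirchSwinnertonDyer.Rank1Residual.F1Sign2.BranchCongruenceModTwoAtTwo
import Summits.BirchSwinnertonDyer.Rank1Residual.F1Sign2.AnalyticLineTransferAtTwo
import Literature.NumberTheory.EllipticCurves.ModTwoReducibleIffTwoTorsionRoot
import Literature.NumberTheory.EllipticCurves.TwoAdicImageQuadraticTwistProofs
import HarnessLib

/-!
# Route `ByReductionTypeAtTwo` (K4) / cell bsd-f1-sign2 crux IMC-K2μ — **`F1Sign2.AnalyticMuZeroAtTwo` PROVED**: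
# analytic `μ = 0` at `2` for every curve good ordinary at `2` without a rational `2`-torsion abscissa

Cell `bsd-2adic`, seat `bsd-2adic-tower-1` (GEN 24), `--supports stmt-BirchSwinnertonDyer-19271` (helper; the literal
spellings of the consumers of `ByReductionTypeAtTwoAnalyticMuZero` named by planner RC-254).  Theorems only; no
definition, no named fact, no `sorry`.

* the cells' binder «no rational `2`-torsion abscissa» (`∀ x, ¬ HasRationalTwoTorsionX W x`) implies `E[2]`
  irreducible (a reducible `E[2]` has a Galois-stable line, i.e. a rational root of the `2`-division cubic
  `4x³ + b₂x² + 2b₄x + b₆`: `exists_isRoot_twoTorsionPolynomial_of_not_hasIrreducibleModPGaloisRep_two`,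
  `hasRationalTwoTorsionX_iff_twoDivision`; the tree's `AlignedTransportAtTwoClosure.irr_two_of_forall_not_hasRationalTwoTorsionX`
  says the same behind a Theses import, so it is re-derived inline here).
* **`analyticMuZeroAtTwo_holds : F1Sign2.AnalyticMuZeroAtTwo`** — bsd-f1-sign2's `@[conjecture]` crux IMC-K2μ
  («THE OPEN crux … Greenberg's Conjecture 1.11 read on the analytic side at `p = 2`; REF2 v2: OPEN-IN-PRINT»), now a
  kernel theorem: for `W` good ordinary at `2` with no rational `2`-torsion abscissa, every newform `f` of `W` and every
  `G ∈ Λ₂` with `ι G = L₂(f, α, T)` has `red G ≠ 0`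
  (`ByReductionTypeAtTwoAnalyticMuZero.red_ne_zero_of_iwasawaToPowerSeries_eq_padicLFunction_two`).
* `red_ne_zero_of_isEvenBranchLiftAtTwo_of_isOrdinaryAt` — the same in the `IsEvenBranchLiftAtTwo` currency of
  `F1Sign2.AnalyticLineTransferAtTwo` (the `hμan` binder shape of
  `Theorems/AlignedTransportAtTwoMainConjectureOfRankZeroBSDAtTwoMuNecessity.lean`) at a good ORDINARY `2` (the
  multiplicative branch of that predicate is vacuous under good reduction).

HONEST FRAMING: see `ByReductionTypeAtTwoAnalyticMuZero` (beyond-print kernel theorem resting on THEOREM B of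
bsd-f3-mu / bsd-print-x8); nothing booked; no crux is closed by this file (IMC-K2μ is bsd-f1-sign2's to close, by
name); BSD is not proved by any of this.

References: [GreenbergLNM1716] §1 Conj. 1.11; [SilvermanAEC2009] III.2.3; [MazurTateTeitelbaum1986Invent] §I.10–I.13.
-/

-- the summit namespace repeats `BirchSwinnertonDyer` by design (summit = problem); linter moot
set_option linter.dupNamespace false
set_option autoImplicit false

noncomputable section

namespace Summit.BirchSwinnertonDyer.BirchSwinnertonDyer.Theorems.AnalyticMuTwo

open scoped MatrixGroups ModularForm

open CongruenceSubgroup WeierstrassCurve Literature.NumberTheory.EllipticCurves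
  Literature.NumberTheory.EllipticCurves.ModularForms Literature.NumberTheory.EllipticCurves.Greenberg1999
  Summit.BirchSwinnertonDyer.Rank1Residual



section F1Sign2

/-- **bsd-f1-sign2's crux IMC-K2μ `F1Sign2.AnalyticMuZeroAtTwo`, PROVED**: analytic `μ = 0` at `2` (every integral
lift `G` of `L₂(f, α, T)` has `red G ≠ 0`) for every `W/ℚ` good ordinary at `2` with no rational `2`-torsion abscissa
and every newform `f` of `W`.  By `red_ne_zero_of_iwasawaToPowerSeries_eq_padicLFunction_two` (kernel road P1–P5 of
this seat over THEOREM B) and «no rational `2`-torsion abscissa ⟹ `E[2]` irreducible».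
[cite: GreenbergLNM1716, §1 Conj. 1.11 (posed for all p; the p = 2 analytic reading is ours)]
[cite: MazurTateTeitelbaum1986Invent, §I.10–I.13] -/
theorem analyticMuZeroAtTwo_holds : F1Sign2.AnalyticMuZeroAtTwo := by
  intro W _ _ hord ht N _ f hf G hG
  -- no rational `2`-torsion abscissa ⟹ `E[2]` irreducible (a reducible `E[2]` has a rational root of the
  -- `2`-division cubic; tree: `AlignedTransportAtTwoClosure.irr_two_of_forall_not_hasRationalTwoTorsionX`, re-derived
  -- here route-free from `exists_isRoot_twoTorsionPolynomial_of_not_hasIrreducibleModPGaloisRep_two`)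
  have hirr : W.HasIrreducibleModPGaloisRep 2 := by
    by_contra h
    obtain ⟨x₀, hx₀⟩ := W.exists_isRoot_twoTorsionPolynomial_of_not_hasIrreducibleModPGaloisRep_two h
    rw [isRoot_twoTorsionPolynomial_iff] at hx₀
    exact ht x₀ ((hasRationalTwoTorsionX_iff_twoDivision W x₀).mpr hx₀)
  exact red_ne_zero_of_iwasawaToPowerSeries_eq_padicLFunction_two W hord hirr hf hG

variable (W : WeierstrassCurve ℚ) [W.IsElliptic] [W.IsGloballyMinimal]

/-- **The `IsEvenBranchLiftAtTwo` currency** (`F1Sign2.AnalyticLineTransferAtTwo`; the `hμan` binder shape of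
`AlignedTransportAtTwoMainConjectureOfRankZeroBSDAtTwoMuNecessity`): at a good ORDINARY `2` with `E[2]` irreducible,
every even-branch lift `G` of a newform of `W` has `red G ≠ 0` (the multiplicative branch of the predicate is empty:
good reduction excludes multiplicative reduction, Mathlib `HasGoodReduction.not_hasMultiplicativeReduction`).
[cite: GreenbergLNM1716, §1 Conj. 1.11 (posed for all p; the p = 2 analytic reading is ours)] [cite: SilvermanAEC2009, VII.5 Prop. 5.1] -/
theorem red_ne_zero_of_isEvenBranchLiftAtTwo_of_isOrdinaryAt (hord : IsOrdinaryAt W 2)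
    (hirr : W.HasIrreducibleModPGaloisRep 2) {N : ℕ} [NeZero N] {f : CuspForm (Gamma0 N) 2}
    (hf : IsNewformOf W f) {G : IwasawaAlgebra 2} (hG : F1Sign2.IsEvenBranchLiftAtTwo W f G) :
    X1.MuLambda.red G ≠ 0 := by
  rcases hG with ⟨-, hG⟩ | ⟨hmult, -⟩
  · exact red_ne_zero_of_iwasawaToPowerSeries_eq_padicLFunction_two W hord hirr hf hG
  · exact absurd hmult hord.1.not_hasMultiplicativeReduction

/-- The same with the «no rational `2`-torsion abscissa» binder (verbatim the `hμan` hypothesis shape of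
`AlignedTransportAtTwoMainConjectureOfRankZeroBSDAtTwoMuNecessity.exists_finite_twoTorsion_fineSelmer_of_mazurMainConjecture_two`
at a good ordinary `2`). [cite: GreenbergLNM1716, §1 Conj. 1.11 (posed for all p; the p = 2 analytic reading is ours)] -/
theorem red_ne_zero_of_isEvenBranchLiftAtTwo_of_forall_not_hasRationalTwoTorsionX (hord : IsOrdinaryAt W 2)
    (ht : ∀ x : ℚ, ¬ HasRationalTwoTorsionX W x) :
    ∀ ⦃N : ℕ⦄ [NeZero N] (f : CuspForm (Gamma0 N) 2), IsNewformOf W f →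
      ∀ G : IwasawaAlgebra 2, F1Sign2.IsEvenBranchLiftAtTwo W f G → X1.MuLambda.red G ≠ 0 :=
  fun _ _ _ hf _ hG ↦ by
    have hirr : W.HasIrreducibleModPGaloisRep 2 := by
      by_contra h
      obtain ⟨x₀, hx₀⟩ := W.exists_isRoot_twoTorsionPolynomial_of_not_hasIrreducibleModPGaloisRep_two h
      rw [isRoot_twoTorsionPolynomial_iff] at hx₀
      exact ht x₀ ((hasRationalTwoTorsionX_iff_twoDivision W x₀).mpr hx₀)
    exact red_ne_zero_of_isEvenBranchLiftAtTwo_of_isOrdinaryAt W hord hirr hf hG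

end F1Sign2

end Summit.BirchSwinnertonDyer.BirchSwinnertonDyer.Theorems.AnalyticMuTwo

end
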